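import Summits.BirchSwinnertonDyer.BirchSwinnertonDyer.Theorems.ManinLocalTwoThreeIstarTwoExits
import HarnessLib

/-!
# Kodaira type `Iₙ*` at `2`, exactly — part 2: the loop and the output `Istar (n + 1)` of Tate's algorithm

Summit `BirchSwinnertonDyer`, route `ManinLocalTwoThree` (cell bsd-f2-manin), cruxes C2 `ManinOddAtFour`
(stmt-BirchSwinnertonDyer-22967) and C3 `ManinPrimeToThreeAtNine` (stmt-…-22968); sequel of `…IstarTwoExits` (part 1: `ord c₄` on the
normal form, the two exits exactly).  `R` is a DVR with perfect residue field in which `2` is a uniformiser (e.g. `ℤ₂`).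

* §2 `IstarCharTwo.addVal_Δ_toNat_istarIndexAux` — the `Iₙ*` sub-procedure `istarIndexAux` (Silverman ATAEC IV.9.4 Step 7) followed
  literally, by induction on the fuel with the invariant «`a₁ ∈ 𝔪²` or not» (preserved by every admissible translation,
  `a₁_mem_sq_iff_of_smul`; `2 ∥ a₂` preserved by `OggBound.a₂_not_mem_sq_of_smul`): for the returned index `n`,
  `a₁ ∉ 𝔪²` ⟹ `ord Δ = n + 8` (`n ≥ 2`) or `(n, ord Δ) = (1, 8)`; `a₁ ∈ 𝔪²` ⟹ `ord Δ = n + 10` (`n ≥ 4`) or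
  `(n, ord Δ) ∈ {(1, 8), (2, 12), (2, 13), (3, 12)}`.  (The tree's `addVal_Δ_toNat_le_istarIndexAux_add_eleven` keeps only `≤ n + 11`.)
* §3 `IstarCharTwo.addVal_Δ_toNat_of_kodairaSymbolOfMinimal_eq_Istar_succ` — for the output `Istar (n + 1)` of the literal
  implementation `kodairaSymbolOfMinimal` (Steps 2, 6, 7, bookkeeping as in the tree's
  `le_addVal_Δ_toNat_of_kodairaSymbolOfMinimal_eq_Istar_succ_of_two_mem`): **`(ord c₄, ord Δ) = (4, n + 9)` (`n ≥ 1`) or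
  `(6, n + 11)` (`n ≥ 3`)**, with the small cases `(4, 8)`, `(6, 8 | 12–13 | 12)`; i.e. for type `I_N*`, `N ≥ 4`:
  `(ord c₄, ord Δ) ∈ {(4, N + 8), (6, N + 10)}`, so `ord j = 3 ord c₄ − ord Δ ∈ {4 − N, 8 − N}` (part 3, `…IstarTwoJValuation`,
  reads this over `ℚ` and derives S-an-40′ «pss at 2 ⟹ m₂ ≤ 12»).

HONEST FRAMING: local structure theorems (Tate's algorithm, literally); C2, C3, Manin's conjecture and BSD are not proved.  No
definitions, no named facts, no sorry.  References: [SilvermanATAEC1994] IV.9.4 Step 7, Table 4.1; [Papadopoulos1993] Table IV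
(p = 2), for comparison only.
-/

set_option linter.dupNamespace false
set_option autoImplicit false

noncomputable section

open scoped Classical

open Polynomial IsLocalRing
  Literature.NumberTheory.DiophantineGeometry Literature.NumberTheory.DiophantineGeometry.TateAlgorithm
  Literature.NumberTheory.DiophantineGeometry.TateAlgorithm.CharTwo
open IsDiscreteValuationRing hiding maximalIdeal

namespace Summit.BirchSwinnertonDyer.BirchSwinnertonDyer.Theorems.ManinLocalTwoThree

namespace IstarCharTwo

variable {R : Type*} [CommRing R] [IsDomain R] [IsDiscreteValuationRing R]

/-! ### §2 (continued) The loop -/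

/-- **The `Iₙ*` loop when `2` is a uniformiser, exactly.**  If `V` is normalised for round `m` (`2 ∣ a₁`, `2 ∥ a₂`, `2^{m+2} ∣ a₃`,
`2^{m+3} ∣ a₄`, `2^{2m+4} ∣ a₆`), `Δ ≠ 0` and the fuel satisfies `ord Δ ≤ fuel + m`, then for the returned index `n`:
if `a₁ ∉ 𝔪²` then `ord Δ = n + 8` (`n ≥ 2`) or `(n, ord Δ) = (1, 8)`; if `a₁ ∈ 𝔪²` then `ord Δ = n + 10` (`n ≥ 4`) or
`(n, ord Δ) ∈ {(1, 8), (2, 12), (2, 13), (3, 12)}`.  (The class of `a₁` mod `𝔪²` survives every admissible translation,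
`a₁_mem_sq_iff_of_smul`; the exits are `addVal_Δ_toNat_of_istarA/B`.) [cite: SilvermanATAEC1994, IV.9.4 Step 7] -/
theorem addVal_Δ_toNat_istarIndexAux [PerfectField (ResidueField R)] (h2 : Irreducible (2 : R)) :
    ∀ (fuel m : ℕ) (V : WeierstrassCurve R), V.a₁ ∈ maximalIdeal R → V.a₂ ∈ maximalIdeal R →
      V.a₂ ∉ maximalIdeal R ^ 2 → V.a₃ ∈ maximalIdeal R ^ (m + 2) →
      V.a₄ ∈ maximalIdeal R ^ (m + 3) → V.a₆ ∈ maximalIdeal R ^ (2 * m + 4) → V.Δ ≠ 0 →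
      (addVal R V.Δ).toNat ≤ fuel + m → ∀ n : ℕ, istarIndexAux fuel m V = n →
      (V.a₁ ∉ maximalIdeal R ^ 2 →
        (n = 1 ∧ (addVal R V.Δ).toNat = 8) ∨ (2 ≤ n ∧ (addVal R V.Δ).toNat = n + 8)) ∧
      (V.a₁ ∈ maximalIdeal R ^ 2 →
        (n = 1 ∧ (addVal R V.Δ).toNat = 8) ∨ (n = 2 ∧ 12 ≤ (addVal R V.Δ).toNat ∧ (addVal R V.Δ).toNat ≤ 13) ∨
          (n = 3 ∧ (addVal R V.Δ).toNat = 12) ∨ (4 ≤ n ∧ (addVal R V.Δ).toNat = n + 10)) := by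
  classical
  have h2m : ∀ {x : R} {n : ℕ}, x ∈ maximalIdeal R ^ n ↔ (2 : R) ^ n ∣ x := fun {x n} =>
    mem_maximalIdeal_pow_iff_dvd_of_irreducible h2 x n
  have h2m₁ : ∀ {x : R}, x ∈ maximalIdeal R ↔ (2 : R) ∣ x := fun {x} =>
    mem_maximalIdeal_iff_dvd_of_irreducible h2 x
  intro fuel
  induction fuel with
  | zero =>
    intro m V h1 h2' _ h3 h4 h6 hΔ0 hfuel
    exfalso
    have h11 : V.a₁ ∈ maximalIdeal R ^ 1 := by rwa [pow_one]
    have h21 : V.a₂ ∈ maximalIdeal R ^ 1 := by rwa [pow_one]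
    have hmem : V.Δ ∈ maximalIdeal R ^ (2 * m + 7) :=
      OggBound.Δ_mem_pow_of_a V 1 (m + 3) (2 * m + 4) (2 * m + 5) h11 h21 h3 h4 h6
    have := le_addVal_toNat_of_pow_dvd irreducible_uniformizer hΔ0
      (mem_maximalIdeal_pow_iff_dvd.mp hmem)
    omega
  | succ f ih =>
    intro m V h1 h2' h2n h3 h4 h6 hΔ0 hfuel n hn
    obtain ⟨p, hp⟩ := h2m₁.mp h2'
    have hpu : IsUnit p := by
      rw [isUnit_iff_not_dvd h2]
      rintro ⟨p', hp'⟩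
      exact h2n (h2m.mpr ⟨p', by rw [hp, hp']; ring⟩)
    rw [istarIndexAux_succ] at hn
    dsimp only at hn
    -- first test: exit `n = 2m + 1`
    by_cases hq1 : distinctRootCount
        (X ^ 2 + C (redCoeff V.a₃ (m + 2)) * X - C (redCoeff V.a₆ (2 * m + 4))) = 2
    · rw [if_pos hq1] at hn
      have hne := ne_zero_of_distinctRootCount_monic_eq_two h2 hq1
      have h3n : ¬ uniformizer R ^ (m + 2 + 1) ∣ V.a₃ := fun h =>
        hne ((redCoeff_eq_zero_iff (mem_maximalIdeal_pow_iff_dvd.mp h3)).mpr h)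
      obtain ⟨γ, hγ⟩ := h2m.mp h3
      have hγu : IsUnit γ := by
        rw [isUnit_iff_not_dvd h2]
        rintro ⟨γ', hγ'⟩
        apply h3n
        rw [← mem_maximalIdeal_pow_iff_dvd, h2m]
        exact ⟨γ', by rw [hγ, hγ']; ring⟩
      obtain ⟨hA0, hAu, hAd⟩ := addVal_Δ_toNat_of_istarA h2 V m (h2m₁.mp h1) hp hpu hγ hγu (h2m.mp h4) (h2m.mp h6)
      refine ⟨fun hna ↦ ?_, fun ha ↦ ?_⟩
      · rcases Nat.eq_zero_or_pos m with hm | hm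
        · exact Or.inl ⟨by omega, hA0 hm⟩
        · exact Or.inr ⟨by omega, by have := hAu (fun h ↦ hna (h2m.mpr h)) hm; omega⟩
      · obtain ⟨hA1, hA2⟩ := hAd (h2m.mp ha)
        rcases Nat.lt_or_ge m 2 with hm | hm
        · rcases Nat.eq_zero_or_pos m with hm0 | hm1
          · exact Or.inl ⟨by omega, hA0 hm0⟩
          · exact Or.inr (Or.inr (Or.inl ⟨by omega, hA1 (by omega)⟩))
        · exact Or.inr (Or.inr (Or.inr ⟨by omega, by have := hA2 hm; omega⟩))
    rw [if_neg hq1] at hn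
    -- the `y`-translation exists
    have hexA : ∃ C : WeierstrassCurve.VariableChange R, C.u = 1 ∧
        (C • V).a₁ ∈ maximalIdeal R ∧ (C • V).a₂ ∈ maximalIdeal R ∧
        (C • V).a₃ ∈ maximalIdeal R ^ (m + 3) ∧ (C • V).a₄ ∈ maximalIdeal R ^ (m + 3) ∧
        (C • V).a₆ ∈ maximalIdeal R ^ (2 * m + 5) :=
      exists_variableChange_istarA_of_perfectField h1 h2' h3 h4 h6 hq1
    rw [dif_pos hexA] at hn
    obtain ⟨hu1, hA₁, hA₂, hA₃, hA₄, hA₆⟩ := hexA.choose_spec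
    set V1 := hexA.choose • V with hV1
    have hΔ1 : V1.Δ = V.Δ := Δ_smul_of_u_eq_one hu1 _
    have hA₂n : V1.a₂ ∉ maximalIdeal R ^ 2 :=
      OggBound.a₂_not_mem_sq_of_smul hu1 h1 h2' h2n (Ideal.pow_le_pow_right (by omega) h3)
        (Ideal.pow_le_pow_right (by omega) h4) (Ideal.pow_le_pow_right (by omega) h6) hA₁ hA₂
        (Ideal.pow_le_pow_right (by omega) hA₃) (Ideal.pow_le_pow_right (by omega) hA₄)
        (Ideal.pow_le_pow_right (by omega) hA₆)
    have ha1iff : V1.a₁ ∈ maximalIdeal R ^ 2 ↔ V.a₁ ∈ maximalIdeal R ^ 2 :=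
      a₁_mem_sq_iff_of_smul h2 hu1 h1 h2' (Ideal.pow_le_pow_right (by omega) h3)
        (Ideal.pow_le_pow_right (by omega) h4) (Ideal.pow_le_pow_right (by omega) h6) hA₁ hA₂
        (Ideal.pow_le_pow_right (by omega) hA₃) (Ideal.pow_le_pow_right (by omega) hA₄)
        (Ideal.pow_le_pow_right (by omega) hA₆)
    -- second test: exit `n = 2m + 2`
    by_cases hq2 : distinctRootCount (C (redCoeff V1.a₂ 1) * X ^ 2 +
        C (redCoeff V1.a₄ (m + 3)) * X + C (redCoeff V1.a₆ (2 * m + 5))) = 2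
    · rw [if_pos hq2] at hn
      obtain ⟨p₁, hp₁⟩ := h2m₁.mp hA₂
      have hp₁u : IsUnit p₁ := by
        rw [isUnit_iff_not_dvd h2]
        rintro ⟨p', hp'⟩
        exact hA₂n (h2m.mpr ⟨p', by rw [hp₁, hp']; ring⟩)
      have ha2ne : redCoeff V1.a₂ 1 ≠ 0 := fun h => hA₂n (mem_maximalIdeal_pow_iff_dvd.mpr
        ((redCoeff_eq_zero_iff (by rw [pow_one]; exact mem_maximalIdeal_iff_dvd.mp hA₂)).mp h))
      have hne := ne_zero_of_distinctRootCount_quadratic_eq_two h2 ha2ne hq2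
      have h4n : ¬ uniformizer R ^ (m + 3 + 1) ∣ V1.a₄ := fun h =>
        hne ((redCoeff_eq_zero_iff (mem_maximalIdeal_pow_iff_dvd.mp hA₄)).mpr h)
      obtain ⟨q, hq⟩ := h2m.mp hA₄
      have hqu : IsUnit q := by
        rw [isUnit_iff_not_dvd h2]
        rintro ⟨q', hq'⟩
        apply h4n
        rw [← mem_maximalIdeal_pow_iff_dvd, h2m]
        exact ⟨q', by rw [hq, hq']; ring⟩
      have hΔ10 : V1.Δ ≠ 0 := by rw [hΔ1]; exact hΔ0
      obtain ⟨hBu, hBd⟩ := addVal_Δ_toNat_of_istarB h2 V1 m (h2m₁.mp hA₁) hp₁ hp₁u (h2m.mp hA₃) hq hqu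
        (h2m.mp hA₆) hΔ10
      rw [hΔ1] at hBu hBd
      refine ⟨fun hna ↦ ?_, fun ha ↦ ?_⟩
      · have hna1 : ¬ (2 : R) ^ 2 ∣ V1.a₁ := fun h ↦ hna (ha1iff.mp (h2m.mpr h))
        exact Or.inr ⟨by omega, by have := hBu hna1; omega⟩
      · obtain ⟨hB0, hB1⟩ := hBd (h2m.mp (ha1iff.mpr ha))
        rcases Nat.eq_zero_or_pos m with hm | hm
        · obtain ⟨hlo, hhi⟩ := hB0 hm
          exact Or.inr (Or.inl ⟨by omega, hlo, hhi⟩)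
        · exact Or.inr (Or.inr (Or.inr ⟨by omega, by have := hB1 hm; omega⟩))
    rw [if_neg hq2] at hn
    -- the `x`-translation exists
    have hexB : ∃ C : WeierstrassCurve.VariableChange R, C.u = 1 ∧
        (C • V1).a₁ ∈ maximalIdeal R ∧ (C • V1).a₂ ∈ maximalIdeal R ∧
        (C • V1).a₃ ∈ maximalIdeal R ^ (m + 3) ∧ (C • V1).a₄ ∈ maximalIdeal R ^ (m + 4) ∧
        (C • V1).a₆ ∈ maximalIdeal R ^ (2 * m + 6) :=
      exists_variableChange_istarB_of_perfectField hA₁ hA₂ hA₂n hA₃ hA₄ hA₆ hq2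
    rw [dif_pos hexB] at hn
    obtain ⟨hu2, hB₁, hB₂, hB₃, hB₄, hB₆⟩ := hexB.choose_spec
    set V2 := hexB.choose • V1 with hV2
    have hΔ2 : V2.Δ = V.Δ := (Δ_smul_of_u_eq_one hu2 _).trans hΔ1
    have hB₂n : V2.a₂ ∉ maximalIdeal R ^ 2 :=
      OggBound.a₂_not_mem_sq_of_smul hu2 hA₁ hA₂ hA₂n (Ideal.pow_le_pow_right (by omega) hA₃)
        (Ideal.pow_le_pow_right (by omega) hA₄) (Ideal.pow_le_pow_right (by omega) hA₆) hB₁ hB₂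
        (Ideal.pow_le_pow_right (by omega) hB₃) (Ideal.pow_le_pow_right (by omega) hB₄)
        (Ideal.pow_le_pow_right (by omega) hB₆)
    have ha2iff : V2.a₁ ∈ maximalIdeal R ^ 2 ↔ V1.a₁ ∈ maximalIdeal R ^ 2 :=
      a₁_mem_sq_iff_of_smul h2 hu2 hA₁ hA₂ (Ideal.pow_le_pow_right (by omega) hA₃)
        (Ideal.pow_le_pow_right (by omega) hA₄) (Ideal.pow_le_pow_right (by omega) hA₆) hB₁ hB₂
        (Ideal.pow_le_pow_right (by omega) hB₃) (Ideal.pow_le_pow_right (by omega) hB₄)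
        (Ideal.pow_le_pow_right (by omega) hB₆)
    have key := ih (m + 1) V2 hB₁ hB₂ hB₂n hB₃ hB₄
      (by rw [show 2 * (m + 1) + 4 = 2 * m + 6 by ring]; exact hB₆) (by rw [hΔ2]; exact hΔ0)
      (by rw [hΔ2]; omega) n hn
    rw [hΔ2] at key
    exact ⟨fun hna ↦ key.1 (fun h ↦ hna (ha1iff.mp (ha2iff.mp h))), fun ha ↦ key.2 (ha2iff.mpr (ha1iff.mpr ha))⟩


/-! ### §3 The output `Istar (n + 1)` of Tate's algorithm, exactly -/

/-- **Type `Iₙ*` (`n ≥ 1`) when `2` is a uniformiser: `(ord c₄, ord Δ) = (4, n + 8)` or `(6, n + 10)` for `n ≥ 4`**, and for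
`n ∈ {1, 2, 3}`: `(4, 8) / (6, 8)`, `(4, 10) / (6, 12 or 13)`, `(4, 11) / (6, 12)`.  Stated for the output `Istar (n + 1)` of the
literal implementation `kodairaSymbolOfMinimal` (Steps 2, 6, 7 as in the tree's
`le_addVal_Δ_toNat_of_kodairaSymbolOfMinimal_eq_Istar_succ_of_two_mem`; the loop by `addVal_Δ_toNat_istarIndexAux`).
[cite: SilvermanATAEC1994, IV.9.4 Step 7 and Table 4.1] -/
theorem addVal_Δ_toNat_of_kodairaSymbolOfMinimal_eq_Istar_succ [PerfectField (ResidueField R)]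
    (h2 : Irreducible (2 : R)) (V : WeierstrassCurve R) (hΔ0 : V.Δ ≠ 0) {n : ℕ}
    (hV : V.kodairaSymbolOfMinimal = .Istar (n + 1)) :
    ((addVal R V.c₄).toNat = 4 ∧
      ((n = 0 ∧ (addVal R V.Δ).toNat = 8) ∨ (1 ≤ n ∧ (addVal R V.Δ).toNat = n + 9))) ∨
    ((addVal R V.c₄).toNat = 6 ∧
      ((n = 0 ∧ (addVal R V.Δ).toNat = 8) ∨ (n = 1 ∧ 12 ≤ (addVal R V.Δ).toNat ∧ (addVal R V.Δ).toNat ≤ 13) ∨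
        (n = 2 ∧ (addVal R V.Δ).toNat = 12) ∨ (3 ≤ n ∧ (addVal R V.Δ).toNat = n + 11))) := by
  classical
  have hϖ : Irreducible (uniformizer R) := irreducible_uniformizer
  unfold WeierstrassCurve.kodairaSymbolOfMinimal at hV
  obtain ⟨h1, h2', h3, h4, h5, h6, h7, hidx⟩ :=
    (tateTree_eq_Istar_succ_iff _ _ _ _ _ _ _ _ _ _ _ _ _).mp hV
  rw [not_not] at h1 h2' h3 h4 h5
  -- Steps 2 and 6
  have hex2 := exists_variableChange_step2_of_perfectField V h1
  have hN2 : normalizeStep2 V = hex2.choose • V := dif_pos hex2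
  obtain ⟨hu2, hA₃, hA₄, -⟩ := hex2.choose_spec
  rw [hN2] at h2' h3 h4 h5 h6 h7 hidx
  have hex6 := exists_variableChange_step6_of_perfectField h2' hA₃ hA₄ h3 h5 h4
  have hN6 : normalizeStep6 (hex2.choose • V) = hex6.choose • (hex2.choose • V) :=
    dif_pos hex6
  obtain ⟨hu6, hB₁, hB₂, hB₃, hB₄, hB₆⟩ := hex6.choose_spec
  rw [hN6] at h6 h7 hidx
  set W₆ := hex6.choose • (hex2.choose • V) with hW₆
  have hΔ6 : W₆.Δ = V.Δ := by rw [hW₆, Δ_smul_of_u_eq_one hu6, Δ_smul_of_u_eq_one hu2]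
  have hc₄6 : W₆.c₄ = V.c₄ := by rw [hW₆, c₄_smul_of_u_eq_one hu6, c₄_smul_of_u_eq_one hu2]
  have hΔ60 : W₆.Δ ≠ 0 := by rw [hΔ6]; exact hΔ0
  -- Step 7: the initial translation
  have hex : ∃ C : WeierstrassCurve.VariableChange R, C.u = 1 ∧
      (C • W₆).a₁ ∈ maximalIdeal R ∧ (C • W₆).a₂ ∈ maximalIdeal R ∧ (C • W₆).a₃ ∈ maximalIdeal R ^ 2 ∧
      (C • W₆).a₄ ∈ maximalIdeal R ^ 3 ∧ (C • W₆).a₆ ∈ maximalIdeal R ^ 4 :=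
    exists_variableChange_step7_of_perfectField hB₁ hB₂ hB₃ hB₄ hB₆ h7
  unfold istarIndex at hidx
  dsimp only at hidx
  rw [dif_pos hex] at hidx
  obtain ⟨hu7, hC₁, hC₂, hC₃, hC₄, hC₆⟩ := hex.choose_spec
  set V7 := hex.choose • W₆ with hV7
  have hΔ7 : V7.Δ = V.Δ := (Δ_smul_of_u_eq_one hu7 _).trans hΔ6
  have hc₄7 : V7.c₄ = V.c₄ := (c₄_smul_of_u_eq_one hu7 _).trans hc₄6
  -- `2 ∥ a₂ (V7)`: the cubic of `V7` is a translate of that of `W₆` and equals `T³ + a₂,₁ T²`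
  have hC₂n : V7.a₂ ∉ maximalIdeal R ^ 2 := by
    obtain ⟨hr, hs, ht⟩ := OggBound.t_mem_sq_of_smul hu7 hB₁ hB₂ hB₃ hB₄ hB₆ hC₁ hC₂ hC₃
      (Ideal.pow_le_pow_right (by norm_num) hC₄) (Ideal.pow_le_pow_right (by norm_num) hC₆)
    obtain ⟨c, hc⟩ := OggBound.cubicStep6_smul hu7 hB₁ hB₂ hB₃ hB₄ hB₆ hr hs ht
    intro hC₂2
    obtain ⟨p, hp⟩ := mem_maximalIdeal_iff_dvd.mp hC₂
    obtain ⟨q, hq⟩ := mem_maximalIdeal_pow_iff_dvd.mp hC₄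
    obtain ⟨w, hw⟩ := mem_maximalIdeal_pow_iff_dvd.mp hC₆
    have hϖ0 : residue R (uniformizer R) = 0 :=
      OggBound.residue_eq_zero_of_mem uniformizer_mem_maximalIdeal
    have hp0 : residue R p = 0 := by
      have h' : uniformizer R ^ 1 * 1 * p ∈ maximalIdeal R ^ (1 + 1) := by
        rw [pow_one, mul_one, ← hp]; exact hC₂2
      have := OggBound.mem_pow_of_uniformizer_pow_mul_mem isUnit_one h'
      rw [pow_one] at this
      exact OggBound.residue_eq_zero_of_mem this
    have hq0 : residue R (uniformizer R * q) = 0 := by rw [map_mul, hϖ0, zero_mul]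
    have hw0 : residue R (uniformizer R * w) = 0 := by rw [map_mul, hϖ0, zero_mul]
    have hcubic7 : cubicStep6 V7 = X ^ 3 + C 0 * X ^ 2 + C 0 * X + C 0 := by
      rw [cubicStep6_eq (q := uniformizer R * q) (r := uniformizer R * w) hp (by rw [hq]; ring)
        (by rw [hw]; ring), hp0, hq0, hw0]
    have := OggBound.distinctRootCount_comp_X_add_C (cubicStep6 W₆) c
    rw [← hc, hcubic7, OggBound.distinctRootCount_cube, h7] at this
    exact absurd this (by norm_num)
  -- the loop, exactly
  have key := addVal_Δ_toNat_istarIndexAux h2 (addVal R W₆.Δ).toNat 0 V7 hC₁ hC₂ hC₂n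
    (by simpa using hC₃) (by simpa using hC₄) (by simpa using hC₆) (by rw [hΔ7]; exact hΔ0)
    (by rw [hΔ7, ← hΔ6, add_zero]) (n + 1) hidx
  rw [hΔ7] at key
  have hc₄ := addVal_c₄_toNat_of_normalForm h2 V7 (m := 0) hC₁ hC₂ hC₂n (by simpa using hC₃) (by simpa using hC₄)
  rw [hc₄7] at hc₄
  by_cases ha : V7.a₁ ∈ maximalIdeal R ^ 2
  · right
    refine ⟨hc₄.2 ha, ?_⟩
    rcases key.2 ha with ⟨hn, hd⟩ | ⟨hn, hlo, hhi⟩ | ⟨hn, hd⟩ | ⟨hn, hd⟩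
    · exact Or.inl ⟨by omega, hd⟩
    · exact Or.inr (Or.inl ⟨by omega, hlo, hhi⟩)
    · exact Or.inr (Or.inr (Or.inl ⟨by omega, hd⟩))
    · exact Or.inr (Or.inr (Or.inr ⟨by omega, by omega⟩))
  · left
    refine ⟨hc₄.1 ha, ?_⟩
    rcases key.1 ha with ⟨hn, hd⟩ | ⟨hn, hd⟩
    · exact Or.inl ⟨by omega, hd⟩
    · exact Or.inr ⟨by omega, by omega⟩

end IstarCharTwo

end Summit.BirchSwinnertonDyer.BirchSwinnertonDyer.Theorems.ManinLocalTwoThree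

end
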